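import Literature.MathematicalPhysics.QuantumManyBody.PeriodicBoseGasMomentumSector
import Literature.Barriers.AtomisticToContinuum.KineticGapLengthScalesNarrow
import Mathlib.Data.Complex.BigOperators
import HarnessLib

/-!
# Galilei covariance of the momentum sectors of the periodic Bose gas

Topic `Literature/MathematicalPhysics/QuantumManyBody` (definition item `defn-momentumSectorEnergy`,
second file: the "Galilean covariance on the torus" clause of the request). Companion of
`PeriodicBoseGasMomentumSector.lean` (`HasTotalMomentum`, `momentumSectorEnergy`).

On the torus of side `L` the boost `U_m = exp(2πi m·∑ⱼxⱼ/L)`, `m ∈ ℤ³`, adds the momentum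
`q = 2πm/L` to every particle: `U P U* = P - Mq`, and for the Hamiltonian
`H = ∑ⱼ -Δⱼ + ∑_{i<j} v^per(xᵢ - xⱼ)` (units `ħ = 2m = 1`, particle mass `½`)
`U H U* = H - 2q·P + M|q|²`, so that `H - P²/M` (the energy minus the centre-of-mass kinetic
energy `P²/(2·(M/2))`) is boost invariant [CorneanDerezinskiZin2009, §2.2 (2.1)–(2.3), written
there for mass `1`: `U₁HU₁* = H - (2π/L)P₁ + (2π)²n/(2L²)`, `U₁(H - P²/2n)U₁* = H - P²/2n`].
Consequently the map `k ↦ inf sp H(k) - |k|²/M` on the momentum lattice is invariant under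
`k ↦ k + Mq`, `q ∈ (2π/L)ℤ³` [CorneanDerezinskiZin2009, §2.2 (2.4) and Fig. 2]: the boosted ground
states give the low-lying "centre-of-mass tower" `k = 2πMm̃/L`, `ε = |k|²/M`
[CorneanDerezinskiZin2009, §2.3], whence `c_crit^{L,M} ≤ π/L`.

This file proves these statements at the level of the quadratic form on the `C¹` core, for the
boosted states `PeriodicTrialState.boost` of the tree
(`Literature/Barriers/AtomisticToContinuum/KineticGapLengthScalesNarrow.lean`, where the boost
was introduced for the Galilei-boost witnesses of that barrier; it is imported, not duplicated):

* `HasTotalMomentum.boost` — `U_m` maps the sector `k` into the sector `k + M(2πm/L)`;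
* `HasTotalMomentum.kineticDensity_boost_add` — the pointwise identity
  `|∇(U_mΦ)|² + (|k|²/M)|Φ|² = |∇Φ|² + (|k + Mq|²/M)|Φ|²` for `Φ` of total momentum `k`
  (expand `|∂_{j,a}Φ + i qₐΦ|²`; the cross terms sum to `2 qₐ Re(-i conj(∑ⱼ∂_{j,a}Φ) Φ) = 2kₐqₐ|Φ|²`
  by the momentum eigenvalue equation `∑ⱼ ∂_{j,a}Φ = i kₐ Φ`), written additively in `ℝ≥0∞`;
* `HasTotalMomentum.periodicEnergy_boost_add` — `⟨U_mΦ, H U_mΦ⟩ + |k|²/M = ⟨Φ, HΦ⟩ + |k + Mq|²/M`;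
* `momentumSectorEnergy_add_boost` — **Galilei covariance of the infimum of the energy–momentum
  spectrum**: `inf sp H(k + Mq) + |k|²/M = inf sp H(k) + |k + Mq|²/M` for all `k` and
  `q ∈ (2π/L)ℤ³` (both sides `⊤` off the lattice), i.e. invariance of `inf sp H(k) - |k|²/M`
  (recall `inf sp H(k) ≥ |k|²/M`, `ofReal_norm_sq_div_le_momentumSectorEnergy`);
* `momentumSectorEnergy_boost_zero` — the centre-of-mass tower over the zero-momentum sector:
  `inf sp H(Mq) = inf sp H(0) + M|q|²`.

## References

* [CorneanDerezinskiZin2009] H. D. Cornean, J. Dereziński, P. Ziń, *On the infimum of the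
  energy–momentum spectrum of a homogeneous Bose gas*, J. Math. Phys. 50 (2009) 062103,
  arXiv:math-ph/0511007: §2.2 (2.1)–(2.4) (Galilei covariance on the torus), §2.3 (boosted ground
  states, `c_crit^{n,L} ≤ π/L`).
* [LSSY2005] E. H. Lieb, R. Seiringer, J. P. Solovej, J. Yngvason, *The Mathematics of the Bose
  Gas and its Condensation*, Birkhäuser 2005: Ch. 5 §5.2 (5.23) and footnote 2 (the gauge
  transformation / boost of the ground state, energy `½mNv²` above `E₀`).
-/

noncomputable section

open MeasureTheory Filter Set WithLp
open scoped ENNReal NNReal Topology ComplexConjugate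

namespace Literature.MathematicalPhysics.QuantumManyBody.BoseGas

open Literature.Barriers.AtomisticToContinuum.BoseGas

variable {M : ℕ} {L : ℝ}

/-! ### Boosts shift the momentum sector -/

/-- The boost phase `e^{2πi m·∑ⱼxⱼ/L}` has total momentum `M · 2πm/L` (every particle carries
`q = 2πm/L`). [cite: CorneanDerezinskiZin2009, §2.2 (2.1)] -/
theorem hasTotalMomentum_boostPhase (L : ℝ) (m : Fin 3 → ℤ) :
    HasTotalMomentum ((M : ℝ) • latticeVec (2 * Real.pi / L) m) (boostPhase (N := M) L m) := by
  intro s X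
  unfold boostPhase
  simp only [configSum_apply]
  have hs : (∑ j, (X j + s)) = (∑ j, X j) + (M : ℝ) • s := by
    rw [Finset.sum_add_distrib, Finset.sum_const, Finset.card_univ, Fintype.card_fin,
      Nat.cast_smul_eq_nsmul]
  rw [hs, cellWave_add, mul_comm, cellWave_apply]
  congr 2
  have h1 : (∑ k, (m k : ℝ) * ((M : ℝ) • s) k) = M * ∑ k, (m k : ℝ) * s k := by
    rw [Finset.mul_sum]
    exact Finset.sum_congr rfl fun k _ => by rw [PiLp.smul_apply, smul_eq_mul]; ring
  have h2 : (∑ j, ((M : ℝ) • latticeVec (2 * Real.pi / L) m) j * s j) =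
      M * (2 * Real.pi / L) * ∑ k, (m k : ℝ) * s k := by
    rw [Finset.mul_sum]
    exact Finset.sum_congr rfl fun k _ => by
      simp only [PiLp.smul_apply, smul_eq_mul, latticeVec]; ring
  rw [h1, h2]
  push_cast
  ring

/-- **Boosts shift the sector** (`U P U* = P - Mq`): if `Φ` has total momentum `k`, the boosted
state `Ψ_m = e^{2πi m·∑ⱼxⱼ/L} Φ` has total momentum `k + M(2πm/L)`.
[cite: CorneanDerezinskiZin2009, §2.2 (2.1)] -/
theorem HasTotalMomentum.boost (hL : 0 < L) (m : Fin 3 → ℤ) {k : Space}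
    {Φ : PeriodicTrialState M L} (h : HasTotalMomentum k Φ.ψ) :
    HasTotalMomentum (k + (M : ℝ) • latticeVec (2 * Real.pi / L) m) (Φ.boost hL m).ψ := by
  have h' := (hasTotalMomentum_boostPhase (M := M) L m).mul h
  rw [add_comm] at h'
  exact h'

/-! ### The energy of a boosted state of definite momentum -/

/-- `∑ⱼ ‖uⱼ + w‖² = ∑ⱼ ‖uⱼ‖² + M‖w‖² + 2 Re((∑ⱼ uⱼ) conj w)` in `ℂ`. [folklore] -/
theorem sum_norm_add_const_sq (u : Fin M → ℂ) (w : ℂ) :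
    ∑ i, ‖u i + w‖ ^ 2 = (∑ i, ‖u i‖ ^ 2) + M * ‖w‖ ^ 2 + 2 * ((∑ i, u i) * conj w).re := by
  have h1 : ((∑ i, u i) * conj w).re = ∑ i, (u i * conj w).re := by
    rw [Finset.sum_mul, Complex.re_sum]
  rw [h1, Finset.mul_sum]
  simp only [Complex.sq_norm, Complex.normSq_add, Finset.sum_add_distrib, Finset.sum_const,
    Finset.card_univ, Fintype.card_fin, nsmul_eq_mul]

/-- The cross term: `Re((i kₐ z) conj(i qₐ z)) = kₐ qₐ |z|²`. [folklore] -/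
theorem re_momentum_cross (κ ρ : ℝ) (z : ℂ) :
    (((κ : ℂ) * Complex.I * z) * conj ((ρ : ℂ) * Complex.I * z)).re = κ * ρ * ‖z‖ ^ 2 := by
  simp only [map_mul, Complex.conj_ofReal, Complex.conj_I]
  have h : (κ : ℂ) * Complex.I * z * ((ρ : ℂ) * -Complex.I * conj z) =
      ((κ * ρ : ℝ) : ℂ) * (z * conj z) := by
    have hI : Complex.I * Complex.I = -1 := Complex.I_mul_I
    push_cast
    linear_combination (-(κ : ℂ) * ρ * z * conj z) * hI
  rw [h, Complex.mul_conj, ← Complex.ofReal_mul, Complex.ofReal_re, Complex.normSq_eq_norm_sq]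

/-- The boost coefficient `2πi mₐ/L` is `i qₐ` with `q = 2πm/L`. [folklore] -/
theorem boostCoeff_eq_latticeVec (L : ℝ) (m : Fin 3 → ℤ) (a : Fin 3) :
    (2 * Real.pi * Complex.I * (m a) / L : ℂ) =
      ((latticeVec (2 * Real.pi / L) m a : ℝ) : ℂ) * Complex.I := by
  simp only [latticeVec, PiLp.toLp_apply]
  push_cast
  ring

/-- **Kinetic energy of a boosted state of momentum `k`, one direction**:
`∑ⱼ |∂_{j,a}(U_mΦ)|² = ∑ⱼ |∂_{j,a}Φ|² + (M qₐ² + 2 kₐqₐ)|Φ|²` pointwise, `q = 2πm/L`.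
[cite: CorneanDerezinskiZin2009, §2.2 (2.2)] -/
theorem HasTotalMomentum.sum_norm_sq_fderiv_boost (hL : 0 < L) (m : Fin 3 → ℤ) {k : Space}
    {Φ : PeriodicTrialState M L} (h : HasTotalMomentum k Φ.ψ) (X : Config M) (a : Fin 3) :
    ∑ i, ‖fderiv ℝ (Φ.boost hL m).ψ X (Pi.single i (EuclideanSpace.single a 1))‖ ^ 2 =
      (∑ i, ‖fderiv ℝ Φ.ψ X (Pi.single i (EuclideanSpace.single a 1))‖ ^ 2) +
        (M * (latticeVec (2 * Real.pi / L) m a) ^ 2 +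
          2 * (k a * latticeVec (2 * Real.pi / L) m a)) * ‖Φ.ψ X‖ ^ 2 := by
  have hd : Differentiable ℝ Φ.ψ := Φ.contDiff.differentiable one_ne_zero
  simp only [norm_fderiv_boost, boostCoeff_eq_latticeVec]
  rw [sum_norm_add_const_sq, h.sum_fderiv_apply_single hd X a, re_momentum_cross, norm_mul,
    norm_mul, Complex.norm_real, Complex.norm_I, Real.norm_eq_abs, mul_one, mul_pow, sq_abs]
  ring

/-- `|k + Mq|² = |k|² + 2M k·q + M²|q|²` on `ℝ³`. [folklore] -/
theorem norm_sq_add_smul_three (k q : Space) (c : ℝ) :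
    ‖k + c • q‖ ^ 2 = ‖k‖ ^ 2 + 2 * c * (∑ a, k a * q a) + c ^ 2 * ∑ a, (q a) ^ 2 := by
  rw [EuclideanSpace.real_norm_sq_eq, EuclideanSpace.real_norm_sq_eq]
  simp only [PiLp.add_apply, PiLp.smul_apply, smul_eq_mul, Fin.sum_univ_three]
  ring

/-- **Kinetic energy of a boosted state of momentum `k`** (real form):
`|∇(U_mΦ)|²(X) + (|k|²/M)|Φ(X)|² = |∇Φ|²(X) + (|k + Mq|²/M)|Φ(X)|²`, `q = 2πm/L`.
[cite: CorneanDerezinskiZin2009, §2.2 (2.2)–(2.3)] -/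
theorem HasTotalMomentum.sum_norm_sq_fderiv_boost_add (hL : 0 < L) (m : Fin 3 → ℤ) {k : Space}
    {Φ : PeriodicTrialState M L} (h : HasTotalMomentum k Φ.ψ) (X : Config M) :
    (∑ i, ∑ a : Fin 3, ‖fderiv ℝ (Φ.boost hL m).ψ X (Pi.single i (EuclideanSpace.single a 1))‖ ^ 2) +
        ‖k‖ ^ 2 / M * ‖Φ.ψ X‖ ^ 2 =
      (∑ i, ∑ a : Fin 3, ‖fderiv ℝ Φ.ψ X (Pi.single i (EuclideanSpace.single a 1))‖ ^ 2) +
        ‖k + (M : ℝ) • latticeVec (2 * Real.pi / L) m‖ ^ 2 / M * ‖Φ.ψ X‖ ^ 2 := by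
  rcases Nat.eq_zero_or_pos M with hM | hM
  · subst hM
    simp
  have hMpos : (0 : ℝ) < M := by exact_mod_cast hM
  rw [Finset.sum_comm, Finset.sum_comm (f := fun i (a : Fin 3) =>
    ‖fderiv ℝ Φ.ψ X (Pi.single i (EuclideanSpace.single a 1))‖ ^ 2)]
  simp only [h.sum_norm_sq_fderiv_boost hL m X]
  rw [Finset.sum_add_distrib, ← Finset.sum_mul, norm_sq_add_smul_three]
  simp only [Fin.sum_univ_three]
  field_simp
  ring

/-- **Kinetic energy of a boosted state of momentum `k`** (`ℝ≥0∞` form, as used by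
`kineticDensity`): `|∇(U_mΦ)|² + (|k|²/M)|Φ|² = |∇Φ|² + (|k + Mq|²/M)|Φ|²` pointwise.
[cite: CorneanDerezinskiZin2009, §2.2 (2.2)–(2.3)] -/
theorem HasTotalMomentum.kineticDensity_boost_add (hL : 0 < L) (m : Fin 3 → ℤ) {k : Space}
    {Φ : PeriodicTrialState M L} (h : HasTotalMomentum k Φ.ψ) (X : Config M) :
    kineticDensity (Φ.boost hL m).ψ X +
        ENNReal.ofReal (‖k‖ ^ 2 / M) * ((‖Φ.ψ X‖₊ : ℝ≥0∞)) ^ 2 =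
      kineticDensity Φ.ψ X +
        ENNReal.ofReal (‖k + (M : ℝ) • latticeVec (2 * Real.pi / L) m‖ ^ 2 / M) *
          ((‖Φ.ψ X‖₊ : ℝ≥0∞)) ^ 2 := by
  unfold kineticDensity
  simp only [coe_nnnorm_sq_eq_ofReal]
  rw [← ENNReal.ofReal_mul (by positivity), ← ENNReal.ofReal_mul (by positivity)]
  have hsum : ∀ ψ : Config M → ℂ, (∑ i, ∑ a : Fin 3,
      ENNReal.ofReal (‖fderiv ℝ ψ X (Pi.single i (EuclideanSpace.single a 1))‖ ^ 2)) =
      ENNReal.ofReal (∑ i, ∑ a : Fin 3,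
        ‖fderiv ℝ ψ X (Pi.single i (EuclideanSpace.single a 1))‖ ^ 2) := by
    intro ψ
    rw [ENNReal.ofReal_sum_of_nonneg fun i _ => Finset.sum_nonneg fun a _ => sq_nonneg _]
    exact Finset.sum_congr rfl fun i _ =>
      (ENNReal.ofReal_sum_of_nonneg fun a _ => sq_nonneg _).symm
  rw [hsum, hsum, ← ENNReal.ofReal_add (Finset.sum_nonneg fun i _ => Finset.sum_nonneg
      fun a _ => sq_nonneg _) (by positivity),
    ← ENNReal.ofReal_add (Finset.sum_nonneg fun i _ => Finset.sum_nonneg fun a _ => sq_nonneg _)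
      (by positivity), h.sum_norm_sq_fderiv_boost_add hL m X]

/-- **Energy of a boosted state of momentum `k`** (`U H U* = H - 2q·P + M|q|²` in the sector
`P = k`): `⟨U_mΦ, H U_mΦ⟩ + |k|²/M = ⟨Φ, HΦ⟩ + |k + Mq|²/M`, `q = 2πm/L` (the interaction and
the modulus are unchanged by the boost). [cite: CorneanDerezinskiZin2009, §2.2 (2.2)–(2.3)] -/
theorem HasTotalMomentum.periodicEnergy_boost_add (hL : 0 < L) (v : ℝ → ℝ≥0∞) (m : Fin 3 → ℤ)
    {k : Space} {Φ : PeriodicTrialState M L} (h : HasTotalMomentum k Φ.ψ) :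
    periodicEnergy v (Φ.boost hL m) + ENNReal.ofReal (‖k‖ ^ 2 / M) =
      periodicEnergy v Φ +
        ENNReal.ofReal (‖k + (M : ℝ) • latticeVec (2 * Real.pi / L) m‖ ^ 2 / M) := by
  set c := ENNReal.ofReal (‖k‖ ^ 2 / M) with hc
  set c' := ENNReal.ofReal (‖k + (M : ℝ) • latticeVec (2 * Real.pi / L) m‖ ^ 2 / M) with hc'
  have hmeas : ∀ d : ℝ≥0∞, Measurable fun X : Config M => d * ((‖Φ.ψ X‖₊ : ℝ≥0∞)) ^ 2 :=
    fun d => (Φ.contDiff.continuous.measurable.nnnorm.coe_nnreal_ennreal.pow_const _).const_mul _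
  have hnorm : ∀ d : ℝ≥0∞, d ≠ ⊤ →
      ∫⁻ X in cellN M L, d * ((‖Φ.ψ X‖₊ : ℝ≥0∞)) ^ 2 = d := by
    intro d hd
    rw [lintegral_const_mul' _ _ hd, Φ.norm_eq, mul_one]
  calc periodicEnergy v (Φ.boost hL m) + c
      = periodicEnergy v (Φ.boost hL m) + ∫⁻ X in cellN M L, c * ((‖Φ.ψ X‖₊ : ℝ≥0∞)) ^ 2 := by
        rw [hnorm c ENNReal.ofReal_ne_top]
    _ = ∫⁻ X in cellN M L, (kineticDensity (Φ.boost hL m).ψ X +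
          periodicInteraction v L X * ((‖(Φ.boost hL m).ψ X‖₊ : ℝ≥0∞)) ^ 2) +
            c * ((‖Φ.ψ X‖₊ : ℝ≥0∞)) ^ 2 := by
        unfold periodicEnergy
        rw [lintegral_add_right _ (hmeas c)]
    _ = ∫⁻ X in cellN M L, (kineticDensity Φ.ψ X +
          periodicInteraction v L X * ((‖Φ.ψ X‖₊ : ℝ≥0∞)) ^ 2) +
            c' * ((‖Φ.ψ X‖₊ : ℝ≥0∞)) ^ 2 := by
        refine lintegral_congr fun X => ?_
        rw [nnnorm_boost_sq, add_right_comm, h.kineticDensity_boost_add hL m X, add_right_comm]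
    _ = periodicEnergy v Φ + c' := by
        unfold periodicEnergy
        rw [lintegral_add_right _ (hmeas c'), hnorm c' ENNReal.ofReal_ne_top]

/-! ### Galilei covariance of the infimum of the energy–momentum spectrum -/

/-- `inf sp H(k) + c` as an infimum of shifted energies. [folklore] -/
theorem momentumSectorEnergy_add (v : ℝ → ℝ≥0∞) (M : ℕ) (L : ℝ) (k : Space) (c : ℝ≥0∞) :
    momentumSectorEnergy v M L k + c =
      ⨅ (Ψ : PeriodicTrialState M L) (_ : HasTotalMomentum k Ψ.ψ), (periodicEnergy v Ψ + c) := by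
  unfold momentumSectorEnergy
  rw [ENNReal.iInf_add]
  exact iInf_congr fun Ψ => ENNReal.iInf_add

/-- **Galilei covariance of the infimum of the energy–momentum spectrum in the box**: for every
`k ∈ ℝ³` and `q = 2πm/L ∈ (2π/L)ℤ³`,
`inf sp H(k + Mq) + |k|²/M = inf sp H(k) + |k + Mq|²/M`,
i.e. `inf sp H(k) - |k|²/M` is invariant under `k ↦ k + Mq` (the boosts `U_{±m}` are mutually
inverse bijections between the two sectors shifting the energy form by exactly these constants;
off the lattice both sides are `⊤`). [cite: CorneanDerezinskiZin2009, §2.2 (2.3)–(2.4)] -/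
theorem momentumSectorEnergy_add_boost (hL : 0 < L) (v : ℝ → ℝ≥0∞) (m : Fin 3 → ℤ) (k : Space) :
    momentumSectorEnergy v M L (k + (M : ℝ) • latticeVec (2 * Real.pi / L) m) +
        ENNReal.ofReal (‖k‖ ^ 2 / M) =
      momentumSectorEnergy v M L k +
        ENNReal.ofReal (‖k + (M : ℝ) • latticeVec (2 * Real.pi / L) m‖ ^ 2 / M) := by
  set q : Space := latticeVec (2 * Real.pi / L) m with hq
  have hneg : latticeVec (2 * Real.pi / L) (-m) = -q := by
    ext a; simp [hq, latticeVec, PiLp.toLp_apply]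
  apply le_antisymm
  · -- boost a state of the sector `k` by `+m`
    rw [momentumSectorEnergy_add v M L k]
    refine le_iInf₂ fun Φ hΦ => ?_
    rw [← hΦ.periodicEnergy_boost_add hL v m]
    exact add_le_add (momentumSectorEnergy_le v _ (hΦ.boost hL m)) le_rfl
  · -- boost a state of the sector `k + Mq` back by `-m`
    rw [momentumSectorEnergy_add v M L (k + (M : ℝ) • q)]
    refine le_iInf₂ fun Ψ hΨ => ?_
    have hback := hΨ.boost hL (-m)
    have hE := hΨ.periodicEnergy_boost_add hL v (-m)
    rw [hneg, smul_neg, add_neg_cancel_right] at hback hE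
    rw [← hE]
    exact add_le_add (momentumSectorEnergy_le v _ hback) le_rfl

/-- **The centre-of-mass tower**: `inf sp H(Mq) = inf sp H(0) + M|q|²` for `q ∈ (2π/L)ℤ³`
(boosting the zero-momentum sector; with a translation-invariant ground state these are the
boosted ground states of energy `E + M|q|²`, so `c_crit^{L,M} ≤ π/L`).
[cite: CorneanDerezinskiZin2009, §2.3] -/
theorem momentumSectorEnergy_boost_zero (hL : 0 < L) (v : ℝ → ℝ≥0∞) (m : Fin 3 → ℤ) :
    momentumSectorEnergy v M L ((M : ℝ) • latticeVec (2 * Real.pi / L) m) =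
      momentumSectorEnergy v M L 0 +
        ENNReal.ofReal (M * ‖latticeVec (2 * Real.pi / L) m‖ ^ 2) := by
  have h := momentumSectorEnergy_add_boost (M := M) hL v m 0
  rw [zero_add, norm_zero, zero_pow two_ne_zero, zero_div, ENNReal.ofReal_zero, add_zero,
    norm_smul, mul_pow, Real.norm_eq_abs, sq_abs] at h
  rcases Nat.eq_zero_or_pos M with hM | hM
  · subst hM
    simp only [Nat.cast_zero, zero_smul, zero_mul, ENNReal.ofReal_zero, add_zero]
  · rw [h]
    congr 2
    have hMpos : (0 : ℝ) < M := by exact_mod_cast hM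
    field_simp

end Literature.MathematicalPhysics.QuantumManyBody.BoseGas

end
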